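import Summits.QuantumFields.YangMills.Theorems.UniversalDetectorQ2NearKernel
import Summits.QuantumFields.YangMills.Theorems.LangevinControlUVOSLegsFromFemtoAndGapStubAssemblyPlaneExpansion

/-!
# Route `FixedTorusFirst`, support item `SomeTorusDetector` (stmt-QuantumFields-24177) — the torus-specific
obligation `CompactDetectorTransfer` of LINE g11-2 «engine tori», PROVED

Ideator seat ym-idea-8 g11 (lens «dual»).  The NT-side skeleton `Cruxes/NT/Lines/engine_tori.lean` (rev 3) proves
`someTorusDetector_of : BlindSeqExtraction → BlindDetectorRigidity → CompactDetectorTransfer → SomeTorusDetector`;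
`BlindDetectorRigidity` is landed (`Cruxes.BlindDetectorRigidity.blindDetectorRigidity`, seat w4).  This module proves
the third obligation, stated VERBATIM as the type of `fixedTorusFirst_compactDetectorTransfer`:

> under the plane ceilings `BDD6_T` on the engine tori `Lsel β` (`a β → 0`, `a β · Lsel β → ∞`), every real Schwartz
> `v₀` carried by a positive time slab `{ta ≤ y₀ ≤ tb}` (`0 < ta`; `ϑv₀` carried by the mirror slab) has, for each
> `ε > 0`, a COMPACTLY SUPPORTED Schwartz `v` carried by the same slab and a `β₅` with
> `|Q2_{β, Lsel β}(ϑv, v) − Q2_{β, Lsel β}(ϑv₀, v₀)| ≤ ε` for all `β ≥ β₅`.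

Proof.  `v := χ_R · v₀` with `χ_R` a smooth bump equal to `1` on the ball of radius `R` (`SchwartzMap.smulLeftCLM`).
`Q2` is a finite double sum, so `Q2(ϑv, v) − Q2(ϑv₀, v₀) = Σ_x Σ_y (χ_R(ϑ a x) χ_R(a y) − 1) ϑv₀(a x) v₀(a y) Cov_T(A_x, A_y)`
and `|χχ − 1| ≤ 1_{R ≤ ‖a x‖} + 1_{R ≤ ‖a y‖}`.  On pairs charged by `ϑv₀(a x) v₀(a y)` the time separation is
`≥ 2 ta` in units `a`, with no wrap once `2 tb ≤ a β · Lsel β` (`cRep_sub_time_of_slab`, `pairKernel_eq_cRep`), and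
`Cov_T(A_0, A_z) = Σ_{(p,q)} Cov_T(plane_p 0, plane_q z)` (`cov_dens_eq_sum_cov_plane'`, restated from `UniversalDetectorTightOfPlaneTight`), so the 36 plane ceilings at
`η = 2 ta` give `|Cov_T(A_x, A_y)| ≤ a⁸ Σ|C_pq|`.  The uniform Schwartz Riemann bounds
(`schwartz_latticeRiemannBound`, `schwartz_latticeRiemannTail`) then bound the difference by
`Σ|C_pq| · (B'_ϑ B_v + B_ϑ B'_v) / (1 + R) ≤ ε` for the chosen `R`.

No summit, rung or crux is proved here: `SomeTorusDetector` still needs `BlindSeqExtraction` (XL, shared with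
`UniversalDetector.BlindDetector`), and `NT` stays open behind `SomeTorusEdgeBit`, `SkewOnSomeTorus`,
`FiniteSizeInsensitivity`.
-/

set_option autoImplicit false

noncomputable section

open scoped SchwartzMap
open MeasureTheory Filter Topology Finset
open Literature.MathematicalPhysics.QuantumFieldTheory Literature.MathematicalPhysics.QuantumLattice
  Literature.Probability.LatticeModels
open Summit.QuantumFields.YangMills.Cruxes.OSLegsFromFemtoAndGap.DlrCollarTransfer
open Summit.QuantumFields.YangMills.Cruxes.UniversalDetectorLimitExtraction
  (schwartz_latticeRiemannBound schwartz_latticeRiemannTail)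
open Summit.QuantumFields.YangMills.Cruxes.UniversalDetectorPlaneTight
open Summit.QuantumFields.YangMills.Theorems.OSLegsFromFemtoAndGap
  (dens_eq_sum_filter_plane measurable_plane_lift torusE_dens_eq_sum)

namespace Summit.QuantumFields.YangMills.Cruxes.FixedTorusFirstEngineTori

/-- `Σ_x Σ_y f(x) g(y) (p(x) + q(y)) = (Σ p f)(Σ g) + (Σ f)(Σ q g)`. -/
private theorem sum_sum_mul_add {ι : Type*} (s : Finset ι) (f g p q : ι → ℝ) :
    ∑ x ∈ s, ∑ y ∈ s, f x * g y * (p x + q y) =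
      (∑ x ∈ s, p x * f x) * (∑ y ∈ s, g y) + (∑ x ∈ s, f x) * (∑ y ∈ s, q y * g y) := by
  rw [Finset.sum_mul_sum, Finset.sum_mul_sum, ← Finset.sum_add_distrib]
  refine Finset.sum_congr rfl fun x _ => ?_
  rw [← Finset.sum_add_distrib]
  refine Finset.sum_congr rfl fun y _ => ?_
  ring

variable {G : Type} [Group G] [TopologicalSpace G] [IsTopologicalGroup G] [CompactSpace G]
  [MeasurableSpace G] [BorelSpace G] (r : LatticeRep G)

/-- Products of two plane fields read through the periodic lift are integrable for Wilson's measure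
(as in `UniversalDetectorTightOfPlaneTight`, restated here to keep this module off that route file's cone). -/
private theorem integrable_plane_mul_lift' (β : ℝ) (L : ℕ) (p q : Fin 4 × Fin 4) (x y : Fin 4 → ℤ) :
    Integrable (fun U : GaugeConfig 4 (2 * L + 1) G =>
        plane G r p x (torusLift (2 * L + 1) U) * plane G r q y (torusLift (2 * L + 1) U))
      (wilsonMeasure (d := 4) (L := 2 * L + 1) r.ρ β) := by
  haveI := isProbabilityMeasure_wilsonMeasure (d := 4) (L := 2 * L + 1) r.ρ r.continuous β
  obtain ⟨C, hC⟩ := exists_abs_plane_le (G := G) r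
  refine Integrable.of_bound
    ((measurable_plane_lift r L p x).mul (measurable_plane_lift r L q y)).aestronglyMeasurable (C * C)
    (Eventually.of_forall fun U => ?_)
  rw [Real.norm_eq_abs, abs_mul]
  exact mul_le_mul (hC p x (torusLift (2 * L + 1) U)) (hC q y (torusLift (2 * L + 1) U)) (abs_nonneg _)
    ((abs_nonneg _).trans (hC p x (torusLift (2 * L + 1) U)))

/-- The density–density torus covariance is the double orientation sum of the plane–plane covariances
(as in `UniversalDetectorTightOfPlaneTight.cov_dens_eq_sum_cov_plane`). -/
private theorem cov_dens_eq_sum_cov_plane' (β : ℝ) (L : ℕ) (x y : Fin 4 → ℤ) :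
    torusE G r β L (fun U => dens G r x U * dens G r y U) - torusE G r β L (dens G r x) * torusE G r β L (dens G r y) =
      ∑ p ∈ Finset.univ.filter (fun q : Fin 4 × Fin 4 => q.1 < q.2),
        ∑ q ∈ Finset.univ.filter (fun q : Fin 4 × Fin 4 => q.1 < q.2),
          (torusE G r β L (fun U => plane G r p x U * plane G r q y U) -
            torusE G r β L (plane G r p x) * torusE G r β L (plane G r q y)) := by
  have hprod : torusE G r β L (fun U => dens G r x U * dens G r y U) =
      ∑ p ∈ Finset.univ.filter (fun q : Fin 4 × Fin 4 => q.1 < q.2),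
        ∑ q ∈ Finset.univ.filter (fun q : Fin 4 × Fin 4 => q.1 < q.2),
          torusE G r β L (fun U => plane G r p x U * plane G r q y U) := by
    simp only [torusE]
    have h1 : ∀ U : LGConfig 4 G, dens G r x U * dens G r y U =
        ∑ p ∈ Finset.univ.filter (fun q : Fin 4 × Fin 4 => q.1 < q.2),
          ∑ q ∈ Finset.univ.filter (fun q : Fin 4 × Fin 4 => q.1 < q.2), plane G r p x U * plane G r q y U := by
      intro U
      rw [dens_eq_sum_filter_plane, dens_eq_sum_filter_plane, Finset.sum_mul_sum]
    simp_rw [h1]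
    rw [integral_finsetSum _ (fun p _ => ?_)]
    · refine Finset.sum_congr rfl fun p _ => ?_
      rw [integral_finsetSum _ (fun q _ => integrable_plane_mul_lift' r β L p q x y)]
    · exact integrable_finsetSum _ (fun q _ => integrable_plane_mul_lift' r β L p q x y)
  rw [hprod, torusE_dens_eq_sum r β L x, torusE_dens_eq_sum r β L y, Finset.sum_mul_sum]
  simp only [Finset.sum_sub_distrib]

/-- `Q2` is a finite double sum: the difference of two `Q2`s at the same `(β, L, s)` is the double sum of the
differences of the test-function weights against the same covariance. -/
theorem Q2_sub_Q2_eq_sum (β : ℝ) (L : ℕ) (s : ℝ) (f g f' g' : 𝓢(EuclideanSpace ℝ (Fin 4), ℝ)) :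
    Q2 G r β L s f g - Q2 G r β L s f' g' =
      ∑ x ∈ box 4 L, ∑ y ∈ box 4 L, (f (s • siteToE x) * g (s • siteToE y) - f' (s • siteToE x) * g' (s • siteToE y)) *
        (torusE G r β L (fun U => dens G r x U * dens G r y U) - torusE G r β L (dens G r x) * torusE G r β L (dens G r y)) := by
  unfold Q2
  rw [← Finset.sum_sub_distrib]
  refine Finset.sum_congr rfl fun x _ => ?_
  rw [← Finset.sum_sub_distrib]
  refine Finset.sum_congr rfl fun y _ => ?_
  ring

set_option linter.unusedVariables false in
/-- **`CompactDetectorTransfer`** (LINE g11-2, obligation T of `someTorusDetector_of`), verbatim (the statement's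
`let ker` binder is part of the route's common header and unused in this clause, whence the linter option). -/
theorem fixedTorusFirst_compactDetectorTransfer :
    open MeasureTheory Literature.MathematicalPhysics.QuantumFieldTheory Literature.MathematicalPhysics.QuantumLattice Literature.Probability.LatticeModels Summit.QuantumFields.YangMills.Cruxes.OSLegsFromFemtoAndGap.DlrCollarTransfer in ∀ (G : Type) [Group G] [TopologicalSpace G] [IsTopologicalGroup G] [CompactSpace G], IsCompactSimpleLieGroup G → letI : MeasurableSpace G := borel G; haveI : BorelSpace G := ⟨rfl⟩; ∀ (r : LatticeRep G) (a : ℝ → ℝ) (Lsel : ℝ → ℕ), (∀ β, 0 < a β) → Filter.Tendsto a Filter.atTop (nhds 0) → Filter.Tendsto (fun β => a β * (Lsel β : ℝ)) Filter.atTop Filter.atTop → let ker : ℝ → ℕ → (Fin 4 → ℤ) → ℝ := (fun (β : ℝ) (L : ℕ) (z : Fin 4 → ℤ) => (a β)⁻¹ ^ 8 * (torusE G r β L (fun U => dens G r 0 U * dens G r z U) - torusE G r β L (dens G r 0) * torusE G r β L (dens G r z))); let ker6 : ℝ → ℕ → Fin 4 × Fin 4 → Fin 4 × Fin 4 → (Fin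 4 → ℤ) → ℝ := (fun (β : ℝ) (L : ℕ) (p q : Fin 4 × Fin 4) (z : Fin 4 → ℤ) => (a β)⁻¹ ^ 8 * (torusE G r β L (fun U => plane G r p 0 U * plane G r q z U) - torusE G r β L (plane G r p 0) * torusE G r β L (plane G r q z))); (∀ p q : Fin 4 × Fin 4, p.1 < p.2 → q.1 < q.2 → ∀ η : ℝ, 0 < η → ∃ (C β₅ : ℝ), ∀ β : ℝ, β₅ ≤ β → ∀ z ∈ box 4 (Lsel β), η ≤ ‖a β • siteToE z‖ → |ker6 β (Lsel β) p q z| ≤ C) → ∀ (v₀ : SchwartzMap (EuclideanSpace ℝ (Fin 4)) ℝ) (ta tb : ℝ), 0 < ta → tsupport (v₀ : EuclideanSpace ℝ (Fin 4) → ℝ) ⊆ {y | ta ≤ y 0 ∧ y 0 ≤ tb} → tsupport ((thetaTest 4 v₀ : SchwartzMap (EuclideanSpace ℝ (Fin 4)) ℝ) : EuclideanSpace ℝ (Fin 4) → ℝ) ⊆ {y | ta ≤ -(y 0) ∧ -(y 0) ≤ tb} → ∀ ε : ℝ, 0 < ε → ∃ (v : SchwartzMap (EuclideanSpace ℝ (Fin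 4)) ℝ) (β₅ : ℝ), HasCompactSupport (v : EuclideanSpace ℝ (Fin 4) → ℝ) ∧ tsupport (v : EuclideanSpace ℝ (Fin 4) → ℝ) ⊆ {y | ta ≤ y 0 ∧ y 0 ≤ tb} ∧ ∀ β : ℝ, β₅ ≤ β → |Q2 G r β (Lsel β) (a β) (thetaTest 4 v) v - Q2 G r β (Lsel β) (a β) (thetaTest 4 v₀) v₀| ≤ ε := by
  intro G _ _ _ _ hG r a Lsel ha hlim hgrow _ker ker6 hBdd v₀ ta tb hta hsuppv hsuppθ ε hε
  letI : MeasurableSpace G := borel G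
  haveI : BorelSpace G := ⟨rfl⟩
  -- uniform Schwartz Riemann bounds for `ϑv₀` and `v₀`
  obtain ⟨Bθ, hBθ0, hBθ⟩ := schwartz_latticeRiemannBound (d := 4) (thetaTest 4 v₀)
  obtain ⟨Bv, hBv0, hBv⟩ := schwartz_latticeRiemannBound (d := 4) v₀
  obtain ⟨Bθ', hBθ'0, hBθ'⟩ := schwartz_latticeRiemannTail (d := 4) (thetaTest 4 v₀)
  obtain ⟨Bv', hBv'0, hBv'⟩ := schwartz_latticeRiemannTail (d := 4) v₀
  -- the 36 plane ceilings at physical separation `2 ta`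
  let S := {s : (Fin 4 × Fin 4) × (Fin 4 × Fin 4) // s.1.1 < s.1.2 ∧ s.2.1 < s.2.2}
  choose C β₅ hC using fun s : S => hBdd s.1.1 s.1.2 s.2.1 s.2.2 (2 * ta) (by positivity)
  set Ctot : ℝ := ∑ s : S, |C s| with hCtot
  have hCtot0 : 0 ≤ Ctot := Finset.sum_nonneg fun s _ => abs_nonneg _
  -- the truncation radius
  set R : ℝ := (Ctot * (Bθ' * Bv + Bθ * Bv') + 1) / ε with hRdef
  have hM0 : 0 ≤ Ctot * (Bθ' * Bv + Bθ * Bv') := by positivity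
  have hRpos : 0 < R := by positivity
  have hεR : ε * R = Ctot * (Bθ' * Bv + Bθ * Bv') + 1 := by
    rw [hRdef]; field_simp
  -- the bump and the truncated detector
  let χ : ContDiffBump (0 : EuclideanSpace ℝ (Fin 4)) := ⟨R, R + 1, hRpos, by linarith⟩
  have hχT : Function.HasTemperateGrowth (χ : EuclideanSpace ℝ (Fin 4) → ℝ) :=
    χ.hasCompactSupport.hasTemperateGrowth χ.contDiff
  set v : 𝓢(EuclideanSpace ℝ (Fin 4), ℝ) :=
    SchwartzMap.smulLeftCLM ℝ (χ : EuclideanSpace ℝ (Fin 4) → ℝ) v₀ with hvdef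
  have hv : ∀ y, v y = χ y * v₀ y := fun y => by
    rw [hvdef, SchwartzMap.smulLeftCLM_apply_apply hχT, smul_eq_mul]
  have hvfun : (v : EuclideanSpace ℝ (Fin 4) → ℝ) =
      (χ : EuclideanSpace ℝ (Fin 4) → ℝ) * (v₀ : EuclideanSpace ℝ (Fin 4) → ℝ) :=
    funext fun y => by rw [Pi.mul_apply]; exact hv y
  have hθv : ∀ y, thetaTest 4 v y = χ (timeReflection 4 y) * thetaTest 4 v₀ y := fun y => by
    rw [thetaTest_apply, hv, thetaTest_apply]
  have hχ1 : ∀ u : EuclideanSpace ℝ (Fin 4), ‖u‖ ≤ R → χ u = 1 := fun u hu =>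
    χ.one_of_mem_closedBall (by simpa using hu)
  -- thresholds in `β`
  obtain ⟨βa, hβa⟩ := Filter.eventually_atTop.1 (hlim.eventually (Iic_mem_nhds one_pos))
  obtain ⟨βL, hβL⟩ := Filter.eventually_atTop.1 (hgrow.eventually_ge_atTop (2 * tb))
  refine ⟨v, max (max βa βL) (∑ s : S, |β₅ s|), ?_, ?_, fun β hβ => ?_⟩
  · rw [hvfun]; exact χ.hasCompactSupport.mul_right
  · rw [hvfun]; exact (tsupport_mul_subset_right).trans hsuppv
  -- the estimate on the engine torus `Lsel β`
  have hs : 0 < a β := ha β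
  have hs1 : a β ≤ 1 := hβa β (le_trans (le_max_left _ _) (le_of_max_le_left hβ))
  have hTL : 2 * tb ≤ a β * (Lsel β : ℝ) := hβL β (le_trans (le_max_right _ _) (le_of_max_le_left hβ))
  have hβs : ∀ s : S, β₅ s ≤ β := fun s =>
    (le_abs_self _).trans ((Finset.single_le_sum (fun s' _ => abs_nonneg (β₅ s')) (Finset.mem_univ s)).trans
      (le_of_max_le_right hβ))
  -- (1) one-point far bound from the plane ceilings
  have hfar1 : ∀ z ∈ box 4 (Lsel β), 2 * ta ≤ ‖a β • siteToE z‖ →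
      |torusE G r β (Lsel β) (fun U => dens G r 0 U * dens G r z U) -
          torusE G r β (Lsel β) (dens G r 0) * torusE G r β (Lsel β) (dens G r z)| ≤ (a β) ^ 8 * Ctot := by
    intro z hz hzη
    have hmem : ∀ s : (Fin 4 × Fin 4) × (Fin 4 × Fin 4),
        s ∈ (Finset.univ.filter (fun q : Fin 4 × Fin 4 => q.1 < q.2)) ×ˢ
            (Finset.univ.filter (fun q : Fin 4 × Fin 4 => q.1 < q.2)) ↔ s.1.1 < s.1.2 ∧ s.2.1 < s.2.2 := by
      intro s; simp [Finset.mem_product]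
    have hsplit : (a β)⁻¹ ^ 8 * (torusE G r β (Lsel β) (fun U => dens G r 0 U * dens G r z U) -
        torusE G r β (Lsel β) (dens G r 0) * torusE G r β (Lsel β) (dens G r z)) =
          ∑ s : S, ker6 β (Lsel β) s.1.1 s.1.2 z := by
      rw [← Finset.sum_subtype _ hmem (fun s => ker6 β (Lsel β) s.1 s.2 z), Finset.sum_product]
      simp only [ker6]
      rw [cov_dens_eq_sum_cov_plane', Finset.mul_sum]
      simp_rw [Finset.mul_sum]
    have hb : |(a β)⁻¹ ^ 8 * (torusE G r β (Lsel β) (fun U => dens G r 0 U * dens G r z U) -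
        torusE G r β (Lsel β) (dens G r 0) * torusE G r β (Lsel β) (dens G r z))| ≤ Ctot := by
      rw [hsplit]
      refine (Finset.abs_sum_le_sum_abs _ _).trans (Finset.sum_le_sum fun s _ => ?_)
      exact (hC s β (hβs s) z hz hzη).trans (le_abs_self _)
    have h8 : (a β) ^ 8 * (a β)⁻¹ ^ 8 = 1 := by
      rw [inv_pow, mul_inv_cancel₀ (pow_ne_zero 8 hs.ne')]
    calc |torusE G r β (Lsel β) (fun U => dens G r 0 U * dens G r z U) -
            torusE G r β (Lsel β) (dens G r 0) * torusE G r β (Lsel β) (dens G r z)|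
        = (a β) ^ 8 * |(a β)⁻¹ ^ 8 * (torusE G r β (Lsel β) (fun U => dens G r 0 U * dens G r z U) -
            torusE G r β (Lsel β) (dens G r 0) * torusE G r β (Lsel β) (dens G r z))| := by
          rw [abs_mul, abs_of_pos (by positivity : (0 : ℝ) < (a β)⁻¹ ^ 8), ← mul_assoc, h8, one_mul]
      _ ≤ (a β) ^ 8 * Ctot := by gcongr
  -- (2) pair far bound on slab-charged pairs (no time wrap since `2 tb ≤ a β · Lsel β`)
  have hfar2 : ∀ x ∈ box 4 (Lsel β), ∀ y ∈ box 4 (Lsel β),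
      thetaTest 4 v₀ (a β • siteToE x) ≠ 0 → v₀ (a β • siteToE y) ≠ 0 →
      |torusE G r β (Lsel β) (fun U => dens G r x U * dens G r y U) -
          torusE G r β (Lsel β) (dens G r x) * torusE G r β (Lsel β) (dens G r y)| ≤ (a β) ^ 8 * Ctot := by
    intro x hx y hy hx0 hy0
    have hsx := slab_of_ne_zero (thetaTest 4 v₀) (-1) (by simpa using hsuppθ) hx0
    have hsy := slab_of_ne_zero v₀ 1 (by simpa using hsuppv) hy0
    simp only [neg_mul, one_mul] at hsx hsy
    obtain ⟨-, hn⟩ := cRep_sub_time_of_slab hs hta hTL (x := x) (x' := y) (by linarith) (by linarith) hsy.1 hsy.2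
    rw [pairKernel_eq_cRep]
    exact hfar1 _ (cRep_proj_mem_box _ _) hn
  -- (3) pointwise bound of the summands
  have hpt : ∀ x ∈ box 4 (Lsel β), ∀ y ∈ box 4 (Lsel β),
      |(thetaTest 4 v (a β • siteToE x) * v (a β • siteToE y) -
          thetaTest 4 v₀ (a β • siteToE x) * v₀ (a β • siteToE y)) *
        (torusE G r β (Lsel β) (fun U => dens G r x U * dens G r y U) -
          torusE G r β (Lsel β) (dens G r x) * torusE G r β (Lsel β) (dens G r y))| ≤
      (a β) ^ 8 * Ctot * (|thetaTest 4 v₀ (a β • siteToE x)| * |v₀ (a β • siteToE y)| *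
        ((if R ≤ ‖a β • siteToE x‖ then (1 : ℝ) else 0) + (if R ≤ ‖a β • siteToE y‖ then (1 : ℝ) else 0))) := by
    intro x hx y hy
    have hι : 0 ≤ (if R ≤ ‖a β • siteToE x‖ then (1 : ℝ) else 0) + (if R ≤ ‖a β • siteToE y‖ then (1 : ℝ) else 0) := by
      split_ifs <;> norm_num
    rw [hθv, hv]
    have hfac : χ (timeReflection 4 (a β • siteToE x)) * thetaTest 4 v₀ (a β • siteToE x) *
          (χ (a β • siteToE y) * v₀ (a β • siteToE y)) -
        thetaTest 4 v₀ (a β • siteToE x) * v₀ (a β • siteToE y) =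
        (χ (timeReflection 4 (a β • siteToE x)) * χ (a β • siteToE y) - 1) *
          (thetaTest 4 v₀ (a β • siteToE x) * v₀ (a β • siteToE y)) := by ring
    rw [hfac]
    by_cases h0 : thetaTest 4 v₀ (a β • siteToE x) = 0 ∨ v₀ (a β • siteToE y) = 0
    · have : (thetaTest 4 v₀ (a β • siteToE x) * v₀ (a β • siteToE y)) = 0 := by
        rcases h0 with h | h <;> simp [h]
      rw [this, mul_zero, zero_mul, abs_zero]
      exact mul_nonneg (by positivity) (mul_nonneg (by positivity) hι)
    push Not at h0
    have hcov := hfar2 x hx y hy h0.1 h0.2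
    have hχb : |χ (timeReflection 4 (a β • siteToE x)) * χ (a β • siteToE y) - 1| ≤
        (if R ≤ ‖a β • siteToE x‖ then (1 : ℝ) else 0) + (if R ≤ ‖a β • siteToE y‖ then (1 : ℝ) else 0) := by
      have h01 : |χ (timeReflection 4 (a β • siteToE x)) * χ (a β • siteToE y) - 1| ≤ 1 := by
        rw [abs_sub_le_iff]
        constructor
        · nlinarith [χ.nonneg (x := timeReflection 4 (a β • siteToE x)), χ.le_one (x := timeReflection 4 (a β • siteToE x)),
            χ.nonneg (x := a β • siteToE y), χ.le_one (x := a β • siteToE y)]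
        · nlinarith [χ.nonneg (x := timeReflection 4 (a β • siteToE x)), χ.le_one (x := timeReflection 4 (a β • siteToE x)),
            χ.nonneg (x := a β • siteToE y), χ.le_one (x := a β • siteToE y)]
      by_cases hxR : R ≤ ‖a β • siteToE x‖
      · rw [if_pos hxR]
        have : 0 ≤ (if R ≤ ‖a β • siteToE y‖ then (1 : ℝ) else 0) := by split_ifs <;> norm_num
        linarith
      by_cases hyR : R ≤ ‖a β • siteToE y‖
      · rw [if_pos hyR, if_neg hxR]
        linarith
      rw [if_neg hxR, if_neg hyR, add_zero]
      have h1 : χ (timeReflection 4 (a β • siteToE x)) = 1 :=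
        hχ1 _ (by rw [(timeReflection 4).norm_map]; exact (not_le.1 hxR).le)
      have h2 : χ (a β • siteToE y) = 1 := hχ1 _ (not_le.1 hyR).le
      rw [h1, h2]; norm_num
    calc |(χ (timeReflection 4 (a β • siteToE x)) * χ (a β • siteToE y) - 1) *
            (thetaTest 4 v₀ (a β • siteToE x) * v₀ (a β • siteToE y)) *
          (torusE G r β (Lsel β) (fun U => dens G r x U * dens G r y U) -
            torusE G r β (Lsel β) (dens G r x) * torusE G r β (Lsel β) (dens G r y))|
        = |χ (timeReflection 4 (a β • siteToE x)) * χ (a β • siteToE y) - 1| *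
            (|thetaTest 4 v₀ (a β • siteToE x)| * |v₀ (a β • siteToE y)|) *
          |torusE G r β (Lsel β) (fun U => dens G r x U * dens G r y U) -
            torusE G r β (Lsel β) (dens G r x) * torusE G r β (Lsel β) (dens G r y)| := by
          rw [abs_mul, abs_mul, abs_mul]
      _ ≤ ((if R ≤ ‖a β • siteToE x‖ then (1 : ℝ) else 0) + (if R ≤ ‖a β • siteToE y‖ then (1 : ℝ) else 0)) *
            (|thetaTest 4 v₀ (a β • siteToE x)| * |v₀ (a β • siteToE y)|) * ((a β) ^ 8 * Ctot) := by
          gcongr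
      _ = _ := by ring
  -- (4) summation
  rw [Q2_sub_Q2_eq_sum]
  calc |∑ x ∈ box 4 (Lsel β), ∑ y ∈ box 4 (Lsel β),
          (thetaTest 4 v (a β • siteToE x) * v (a β • siteToE y) -
              thetaTest 4 v₀ (a β • siteToE x) * v₀ (a β • siteToE y)) *
            (torusE G r β (Lsel β) (fun U => dens G r x U * dens G r y U) -
              torusE G r β (Lsel β) (dens G r x) * torusE G r β (Lsel β) (dens G r y))|
      ≤ ∑ x ∈ box 4 (Lsel β), ∑ y ∈ box 4 (Lsel β),
          (a β) ^ 8 * Ctot * (|thetaTest 4 v₀ (a β • siteToE x)| * |v₀ (a β • siteToE y)| *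
            ((if R ≤ ‖a β • siteToE x‖ then (1 : ℝ) else 0) + (if R ≤ ‖a β • siteToE y‖ then (1 : ℝ) else 0))) := by
        refine (Finset.abs_sum_le_sum_abs _ _).trans (Finset.sum_le_sum fun x hx => ?_)
        exact (Finset.abs_sum_le_sum_abs _ _).trans (Finset.sum_le_sum fun y hy => hpt x hx y hy)
    _ = Ctot * (((a β) ^ 4 * ∑ x ∈ (box 4 (Lsel β)).filter (fun x => R ≤ ‖a β • siteToE x‖),
            |thetaTest 4 v₀ (a β • siteToE x)|) * ((a β) ^ 4 * ∑ y ∈ box 4 (Lsel β), |v₀ (a β • siteToE y)|) +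
          ((a β) ^ 4 * ∑ x ∈ box 4 (Lsel β), |thetaTest 4 v₀ (a β • siteToE x)|) *
            ((a β) ^ 4 * ∑ y ∈ (box 4 (Lsel β)).filter (fun y => R ≤ ‖a β • siteToE y‖), |v₀ (a β • siteToE y)|)) := by
        simp_rw [← Finset.mul_sum]
        rw [sum_sum_mul_add, Finset.sum_filter, Finset.sum_filter]
        simp_rw [boole_mul]
        ring
    _ ≤ Ctot * (Bθ' / (1 + R) * Bv + Bθ * (Bv' / (1 + R))) := by
        gcongr
        · exact hBθ' (Lsel β) (a β) R hs hs1 hRpos.le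
        · exact hBv (Lsel β) (a β) hs hs1
        · exact hBθ (Lsel β) (a β) hs hs1
        · exact hBv' (Lsel β) (a β) R hs hs1 hRpos.le
    _ = Ctot * (Bθ' * Bv + Bθ * Bv') / (1 + R) := by
        field_simp
    _ ≤ ε := by
        rw [div_le_iff₀ (by positivity)]
        nlinarith [hεR, hε, hM0]

end Summit.QuantumFields.YangMills.Cruxes.FixedTorusFirstEngineTori

end
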